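import Literature.AnabelianGeometry.EtaleTheta.Discharge.Sec2Prop26Reduction
import Literature.AnabelianGeometry.EtaleTheta.Discharge.Sec2Prop24CharacteristicY
import Literature.AnabelianGeometry.EtaleTheta.ThetaCoversOfTypeTempered
import HarnessLib

/-!
# [EtTh] Prop. 2.4 is EQUIVALENT over the interface to its core form (proof-only companion)

Mochizuki, *The étale theta function and its Frobenioid-theoretic manifestations* [EtTh], Publ. RIMS **45**
(2009), §2, Prop. 2.4, PRIMS PDF pp. 38–39 (printed pp. 264–265) [cite: MochizukiEtTh2009, Prop 2.4 p.38]: "any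
isomorphism of topological groups `γ : Π^tp_{X̲̲_α} ⥲ Π^tp_{X̲̲_β}` (resp. `X̲`; `C̲̲`; `C̲`) induces isomorphisms
compatible with the various natural maps between the respective `Π^tp`'s of `X̲, X, C̲̲, C̲, C, Ÿ` (resp. `X, C, Ÿ`;
`C̲, C, X̲̲, X̲, X, Ÿ`; `C, X̲, X, Ÿ`)"; proof p. 39: "As in the proof of Proposition 1.8, it follows from our assumption
that the hyperbolic curve determined by `X^log` admits a `K`-core that `γ` induces `Π^tp_{C_α} ⥲ Π^tp_{C_β}` …".
Cell abc-iut, layer L2, cone node EtTh:Prop2.4 (abc-iut-w6-d094; L2-lead row #127 «census what print's hypotheses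
leave to prove at a datum where Prop 2.4 HOLDS»); companion of abc-iut-L2-t2's `ThetaCoversTempered.lean` (named
fact `TemperedCoverData.Prop24`, FACT-LIST F-0609), abc-iut-L2-t7's `Sec2Prop24Reduction` (uniqueness; the
`X`-clause), abc-iut-w4-d034's `Sec2Prop24CharacteristicY` (the `Y`-clause) and abc-iut-w6-d084's
`Sec2Prop26Reduction` (`prop26_iff_core`).  PURE GROUP THEORY over the interface; no definition, no named fact.

CENSUS.  `Prop24` asks for `6 + 3 + 6 + 4 = 19` stabilisations.  With `Xuu, Xu, X, Cuu, Cu, Ydd, Y` for `Π^tp` of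
`X̲̲, X̲, X, C̲̲, C̲, Ÿ, Y`, the following hold for ANY topological automorphism `Γ` of `Π^tp_C`: the member `Γ` extends
from is stable (w6-d084); `Γ Xuu = Xuu ⟹ Γ X = X`, `Γ Xu = Xu ⟹ Γ X = X` (L2-t7, `4 ∤ 2l², 2l`); `Γ X = X ∧ Γ Ydd =
Ydd ⟹ Γ Y = Y` (w4-d034); NEW `Γ X = X ∧ Γ Y = Y ⟹ Γ Xu = Xu` granted Def. 2.5 (i)(a) `Y ≤ Xu` — `Γ` acts on
`X/Y = Z ≅ ℤ` by `±1` and every subgroup of `ℤ` is `±1`-stable (`map_eq_of_le_of_le_of_quotient_mulEquiv_int`, via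
`eq_or_eq_inv_of_surjective_of_ker_iff`: two surjections onto `ℤ` with one kernel agree up to sign); NEW
`Xuu = Cuu ∩ X`, `Xu = Cu ∩ X` (L2-d3 `PiXu_eq_PiCu_inf_PiX`) and **`Cu = Xu ⊔ Cuu`** (`tp_PiCu_eq_tp_PiXu_sup_tp_PiCuu`,
indices `l, l², 2l`, `l` odd).  Hence **`prop24_iff_core`**: granted Def. 2.5 (i)(a), `Prop24` ⟺ every
`γ ∈ Aut(Π^tp_{X̲̲})` (resp. `Π^tp_{X̲}`; `Π^tp_{C̲̲}`; `Π^tp_{C̲}`) extends to `Π^tp_C` stabilising `Π^tp_{C̲̲}, Π^tp_Ÿ`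
(resp. `Π^tp_Ÿ`; `Π^tp_X, Π^tp_Ÿ`; `Π^tp_X, Π^tp_Ÿ`) — `7` stabilisations; clauses (ii), (iv) need no Def. 2.5
hypothesis.  WHAT PRINT'S HYPOTHESES LEAVE TO PROVE at a datum where Prop. 2.4 holds is this core: (E) the
EXTENSION to `Π^tp_C` (the `K`-core, [Mzk3] Thm. 2.4); (Ÿ) `Γ(Π^tp_Ÿ) = Π^tp_Ÿ` (the Prop. 1.8 step: [AbsAnab]
Lem. 1.3.8, [SemiAnbd] Thm. 6.8 / Cor. 3.11); (X) `Γ(Π^tp_X) = Π^tp_X` in (iii)/(iv) (`X ⊆ C` among the index-`2`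
members, e.g. versus quadratic twists — split singular stable reduction); (C̲̲) `Γ(Π^tp_{C̲̲}) = Π^tp_{C̲̲}` in (i)
(in print from Rmk. 2.6.1, `Aut_K(X̲̲) = μ_l × {±1}` has a unique involution; the bare interface does not carry
`N_{Π^tp_C}(Π^tp_{X̲̲})`, cf. abc-iut-L2-d3's `Sec2AutKHolds` under `hΘ`).  None of these is proved here; at the
tree's semi-synthetic models (E) already fails (`not_forall_prop24`, `not_prop24_temperedCoverData_inversionModelκ'`).
Honest framing: nothing asserts that a `TemperedCoverData` with `Prop24` exists; `Prop24` stays a named input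
(F-0609) where consumed; typed ≠ proved; no side is taken on [IUTchIII] Cor. 3.12 or on any disputed claim.
-/

namespace Literature.AnabelianGeometry.EtaleTheta

namespace ThetaCovers

universe u

/-! ### Group theory: two surjections onto `ℤ` with the same kernel agree up to sign -/

section GroupTheory

variable {G : Type*} [Group G]

/-- Two surjective homomorphisms `π, f : X ↠ ℤ` with the same kernel agree up to the sign automorphism of `ℤ`:
`f = π` or `f = π⁻¹` (`Aut(ℤ) = {±1}`) — the mechanism behind "an automorphism of `Π^tp_X` stabilising `Π^tp_Y`
acts on `Z = Π^tp_X/Π^tp_Y ≅ ℤ` by `±1`" in [EtTh] Prop. 2.4. [cite: MochizukiEtTh2009, Prop 2.4 p.38] -/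
theorem eq_or_eq_inv_of_surjective_of_ker_iff {X : Type*} [Group X] (π f : X →* Multiplicative ℤ)
    (hπ : Function.Surjective π) (hf : Function.Surjective f) (hker : ∀ x, f x = 1 ↔ π x = 1) :
    (∀ x, f x = π x) ∨ (∀ x, f x = (π x)⁻¹) := by
  obtain ⟨x₁, hx₁⟩ := hπ (Multiplicative.ofAdd 1)
  -- every `x` is `x₁ ^ (π x)` modulo the common kernel, so `toAdd (f x) = toAdd (π x) * toAdd (f x₁)`
  have key : ∀ x, Multiplicative.toAdd (f x) = Multiplicative.toAdd (π x) * Multiplicative.toAdd (f x₁) := by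
    intro x
    have h1 : π (x * (x₁ ^ (Multiplicative.toAdd (π x)))⁻¹) = 1 := by
      rw [map_mul, map_inv, map_zpow, hx₁, mul_inv_eq_one, ← ofAdd_zsmul, smul_eq_mul, mul_one, ofAdd_toAdd]
    have h2 : f (x * (x₁ ^ (Multiplicative.toAdd (π x)))⁻¹) = 1 := (hker _).mpr h1
    rw [map_mul, map_inv, map_zpow, mul_inv_eq_one] at h2
    rw [h2, toAdd_zpow, smul_eq_mul]
  -- `toAdd (f x₁)` is a unit of `ℤ`, by surjectivity of `f`
  obtain ⟨x₂, hx₂⟩ := hf (Multiplicative.ofAdd 1)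
  have hunit : Multiplicative.toAdd (f x₁) * Multiplicative.toAdd (π x₂) = 1 := by
    rw [mul_comm, ← key x₂, hx₂, toAdd_ofAdd]
  rcases Int.eq_one_or_neg_one_of_mul_eq_one hunit with hm | hm
  · exact Or.inl fun x => Multiplicative.toAdd.injective (by rw [key x, hm, mul_one])
  · exact Or.inr fun x => Multiplicative.toAdd.injective (by rw [key x, hm, toAdd_inv, mul_neg, mul_one])

/-- If `K.map e = K` for a group automorphism `e`, then also `K.map e⁻¹ = K`. [folklore] -/
private theorem map_symm_eq_of_map_eq (e : G ≃* G) {K : Subgroup G} (h : K.map e.toMonoidHom = K) :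
    K.map e.symm.toMonoidHom = K := by
  conv_lhs => rw [← h]
  have hid : e.symm.toMonoidHom.comp e.toMonoidHom = MonoidHom.id G := by ext x; simp
  rw [Subgroup.map_map, hid, Subgroup.map_id]

/-- For a group automorphism `e` with `K.map e = K`: `e x ∈ K ↔ x ∈ K`. [folklore] -/
private theorem apply_mem_iff_of_map_eq (e : G ≃* G) {K : Subgroup G} (h : K.map e.toMonoidHom = K) (x : G) :
    e x ∈ K ↔ x ∈ K := by
  refine ⟨fun hx => ?_, fun hx => h ▸ ⟨x, hx, rfl⟩⟩
  rw [← h] at hx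
  obtain ⟨y, hy, hyx⟩ := hx
  exact (e.injective hyx : y = x) ▸ hy

/-- **A subgroup squeezed between `Y ⊴ X` with `X/Y ≅ ℤ` is stabilised by every automorphism stabilising `X` and
`Y`** — one inclusion: `Γ X = X`, `Γ Y = Y`, `Y ≤ K ≤ X` ⟹ `Γ K ≤ K`.  `Γ` induces an automorphism of `X/Y ≅ ℤ`,
which is `±1` (`eq_or_eq_inv_of_surjective_of_ker_iff` for `X ↠ ℤ` and its precomposition with `Γ|_X`), so
`Γ k ∈ k^{±1}·Y ⊆ K`.  In [EtTh] Prop. 2.4: `Π^tp_{X̲}`, the inverse image of `l·Z ⊆ Z ≅ ℤ`, is stabilised as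
soon as `Π^tp_X` and `Π^tp_Y` are. [cite: MochizukiEtTh2009, Prop 2.4 p.38] -/
theorem map_le_of_le_of_le_of_quotient_mulEquiv_int (Γ : G ≃* G) {Y K X : Subgroup G} (hYK : Y ≤ K)
    (hKX : K ≤ X) [hN : (Y.subgroupOf X).Normal] (e : ↥X ⧸ Y.subgroupOf X ≃* Multiplicative ℤ)
    (hX : X.map Γ.toMonoidHom = X) (hY : Y.map Γ.toMonoidHom = Y) :
    K.map Γ.toMonoidHom ≤ K := by
  -- the projection `π : X ↠ ℤ` with kernel `Y`, the restriction `Γ|_X`, and `f := π ∘ Γ|_X`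
  let π : ↥X →* Multiplicative ℤ := e.toMonoidHom.comp (QuotientGroup.mk' (Y.subgroupOf X))
  have hπ : Function.Surjective π := e.surjective.comp (QuotientGroup.mk'_surjective _)
  have hπker : ∀ x : ↥X, π x = 1 ↔ (x : G) ∈ Y := by
    intro x
    change e (QuotientGroup.mk' (Y.subgroupOf X) x) = 1 ↔ _
    rw [e.map_eq_one_iff, QuotientGroup.mk'_apply, QuotientGroup.eq_one_iff, Subgroup.mem_subgroupOf]
  have hΓX : ∀ x : ↥X, Γ x ∈ X := fun x => (apply_mem_iff_of_map_eq Γ hX x).mpr x.2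
  let ΓX : ↥X →* ↥X := (Γ.toMonoidHom.comp X.subtype).codRestrict X (fun x => hΓX x)
  have hΓX_apply : ∀ x : ↥X, ((ΓX x : ↥X) : G) = Γ x := fun x => rfl
  let f : ↥X →* Multiplicative ℤ := π.comp ΓX
  have hf : Function.Surjective f := by
    intro z
    obtain ⟨x, hx⟩ := hπ z
    have hx' : Γ.symm x ∈ X := (apply_mem_iff_of_map_eq Γ.symm (map_symm_eq_of_map_eq Γ hX) x).mpr x.2
    refine ⟨⟨Γ.symm x, hx'⟩, ?_⟩
    change π (ΓX ⟨Γ.symm x, hx'⟩) = z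
    have : ΓX ⟨Γ.symm x, hx'⟩ = x := Subtype.ext (by rw [hΓX_apply]; exact Γ.apply_symm_apply x)
    rw [this, hx]
  have hker : ∀ x : ↥X, f x = 1 ↔ π x = 1 := by
    intro x
    change π (ΓX x) = 1 ↔ π x = 1
    rw [hπker, hπker, hΓX_apply]
    exact apply_mem_iff_of_map_eq Γ hY x
  -- hence `f = π^{±1}`, and `Γ k · k^{∓1} ∈ Y ≤ K`
  rintro _ ⟨k, hk, rfl⟩
  change Γ k ∈ K
  have hkX : k ∈ X := hKX hk
  rcases eq_or_eq_inv_of_surjective_of_ker_iff π f hπ hf hker with hfx | hfx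
  · have h1 : π (ΓX ⟨k, hkX⟩ * ⟨k, hkX⟩⁻¹) = 1 := by
      rw [map_mul, map_inv, ← hfx ⟨k, hkX⟩]
      exact mul_inv_cancel _
    rw [hπker] at h1
    change Γ k * k⁻¹ ∈ Y at h1
    rw [show Γ k = (Γ k * k⁻¹) * k by group]
    exact K.mul_mem (hYK h1) hk
  · have h1 : π (ΓX ⟨k, hkX⟩ * ⟨k, hkX⟩) = 1 := by
      rw [map_mul]
      change f ⟨k, hkX⟩ * π ⟨k, hkX⟩ = 1
      rw [hfx ⟨k, hkX⟩]
      exact inv_mul_cancel _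
    rw [hπker] at h1
    change Γ k * k ∈ Y at h1
    rw [show Γ k = (Γ k * k) * k⁻¹ by group]
    exact K.mul_mem (hYK h1) (K.inv_mem hk)

/-- **A subgroup squeezed between `Y ⊴ X` with `X/Y ≅ ℤ` is stabilised by every automorphism stabilising `X` and
`Y`**: `Γ X = X`, `Γ Y = Y`, `Y ≤ K ≤ X` ⟹ `Γ K = K` (the second inclusion from `Γ⁻¹`).
[cite: MochizukiEtTh2009, Prop 2.4 p.38] -/
theorem map_eq_of_le_of_le_of_quotient_mulEquiv_int (Γ : G ≃* G) {Y K X : Subgroup G} (hYK : Y ≤ K)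
    (hKX : K ≤ X) [(Y.subgroupOf X).Normal] (e : ↥X ⧸ Y.subgroupOf X ≃* Multiplicative ℤ)
    (hX : X.map Γ.toMonoidHom = X) (hY : Y.map Γ.toMonoidHom = Y) :
    K.map Γ.toMonoidHom = K := by
  refine le_antisymm (map_le_of_le_of_le_of_quotient_mulEquiv_int Γ hYK hKX e hX hY) fun k hk => ?_
  have h' := map_le_of_le_of_le_of_quotient_mulEquiv_int Γ.symm hYK hKX e (map_symm_eq_of_map_eq Γ hX)
    (map_symm_eq_of_map_eq Γ hY)
  exact ⟨Γ.symm k, h' ⟨k, hk, rfl⟩, Γ.apply_symm_apply k⟩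

end GroupTheory

namespace TemperedCoverData

variable {l : ℕ} (T : TemperedCoverData.{u} l)

/-! ### Lattice identities of the tower inside `Π^tp_C` -/

/-- `Π^tp_{X̲̲} = Π^tp_{C̲̲} ∩ Π^tp_X` (cartesian square `X̲̲ → X` over `C̲̲ → C`, Def. 2.3; the definition of
`T.PiXuu`, through `toHat⁻¹`). [cite: MochizukiEtTh2009, Def 2.3 p.38] -/
theorem tp_PiXuu_eq_inf : T.tp T.PiXuu = T.tp T.PiCuu ⊓ T.tp T.PiX :=
  Subgroup.comap_inf T.PiCuu T.PiX T.toHat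

/-- `Π^tp_{X̲} = Π^tp_{C̲} ∩ Π^tp_X` (cartesian square `X̲ → X` over `C̲ → C`, Def. 2.1; abc-iut-L2-d3's
`PiXu_eq_PiCu_inf_PiX`). [cite: MochizukiEtTh2009, Def 2.1 p.36] -/
theorem tp_PiXu_eq_inf : T.tp T.PiXu = T.tp T.PiCu ⊓ T.tp T.PiX := by
  rw [T.PiXu_eq_PiCu_inf_PiX]
  exact Subgroup.comap_inf T.PiCu T.PiX T.toHat

/-- **`Π^tp_{C̲} = Π^tp_{X̲} ⊔ Π^tp_{C̲̲}` in `Π^tp_C`**: the join contains `Π^tp_{C̲̲}` (index `l²`) and `Π^tp_{X̲}`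
(index `2l`) and is contained in `Π^tp_{C̲}` (index `l`), so its index is a multiple of `l` dividing
`gcd(l², 2l) = l` (`l` odd). [cite: MochizukiEtTh2009, Rmk 2.3.1 p.38] -/
theorem tp_PiCu_eq_tp_PiXu_sup_tp_PiCuu : T.tp T.PiCu = T.tp T.PiXu ⊔ T.tp T.PiCuu := by
  have hl0 : l ≠ 0 := T.toCoverData.l_ne_zero
  set M := T.tp T.PiXu ⊔ T.tp T.PiCuu with hM
  have hXuCu : T.PiXu ≤ T.PiCu := by rw [T.PiXu_eq_PiCu_inf_PiX]; exact inf_le_left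
  have hMle : M ≤ T.tp T.PiCu :=
    sup_le (Subgroup.comap_mono hXuCu) (Subgroup.comap_mono (le_sup_left : T.PiCuu ≤ T.PiCu))
  -- `l ∣ [G : M]`, `[G : M] ∣ 2l`, `[G : M] ∣ l²`, hence `[G : M] = l`
  have h1 : l ∣ M.index := by
    have := Subgroup.index_dvd_of_le hMle
    rwa [T.index_tp T.isOpen_PiCu, T.index_PiCu] at this
  have h2 : M.index ∣ l * 2 := by
    have := Subgroup.index_dvd_of_le (le_sup_left : T.tp T.PiXu ≤ M)
    rwa [T.index_tp T.isOpen_PiXu, T.index_PiXu] at this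
  have h3 : M.index ∣ l * l := by
    have := Subgroup.index_dvd_of_le (le_sup_right : T.tp T.PiCuu ≤ M)
    rwa [T.index_tp T.isOpen_PiCuu, T.index_PiCuu] at this
  have hMi : M.index = l := by
    obtain ⟨k, hk⟩ := h1
    rw [hk] at h2 h3
    rcases (Nat.dvd_prime Nat.prime_two).mp (Nat.dvd_of_mul_dvd_mul_left (Nat.pos_of_ne_zero hl0) h2) with
      rfl | rfl
    · rw [hk, mul_one]
    · exact absurd (even_iff_two_dvd.mpr (Nat.dvd_of_mul_dvd_mul_left (Nat.pos_of_ne_zero hl0) h3))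
        (Nat.not_even_iff_odd.mpr T.l_odd)
  -- equal finite index and `M ≤ Π^tp_{C̲}` give equality
  have hrel := Subgroup.relIndex_mul_index hMle
  rw [hMi, T.index_tp T.isOpen_PiCu, T.index_PiCu] at hrel
  have hone : M.relIndex (T.tp T.PiCu) = 1 :=
    Nat.eq_of_mul_eq_mul_right (Nat.pos_of_ne_zero hl0) (by rw [hrel, one_mul])
  exact le_antisymm (Subgroup.relIndex_eq_one.mp hone) hMle

/-! ### The derived stabilisations -/

variable {T}

/-- **The `X̲`-clause from `X` and `Y`** (granted Def. 2.5 (i)(a) `Π^tp_Y ≤ Π^tp_{X̲}`): an automorphism of `Π^tp_C`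
stabilising `Π^tp_X` and `Π^tp_Y` stabilises `Π^tp_{X̲}` — it acts by `±1` on `Π^tp_X/Π^tp_Y = Z ≅ ℤ`, and
`Π^tp_{X̲}` is the inverse image of a subgroup of `Z`. [cite: MochizukiEtTh2009, Prop 2.4 p.38] -/
theorem map_tp_PiXu_eq_of_map_tp_PiX_of_map_PiYtp (hYXu : T.PiYtp ≤ T.tp T.PiXu) (Γ : T.Gtp ≃ₜ* T.Gtp)
    (hX : (T.tp T.PiX).map Γ.toMulEquiv.toMonoidHom = T.tp T.PiX)
    (hY : T.PiYtp.map Γ.toMulEquiv.toMonoidHom = T.PiYtp) :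
    (T.tp T.PiXu).map Γ.toMulEquiv.toMonoidHom = T.tp T.PiXu := by
  obtain ⟨e⟩ := T.quotZ
  haveI : T.PiYtp.Normal := T.PiYtp_normal
  haveI : (T.PiYtp.subgroupOf (T.tp T.PiX)).Normal := inferInstance
  have hXuX : T.tp T.PiXu ≤ T.tp T.PiX := by rw [T.tp_PiXu_eq_inf]; exact inf_le_right
  exact map_eq_of_le_of_le_of_quotient_mulEquiv_int Γ.toMulEquiv hYXu hXuX e hX hY

/-- **The `X̲̲`-clause from `C̲̲` and `X`** (`Π^tp_{X̲̲} = Π^tp_{C̲̲} ∩ Π^tp_X`). [cite: MochizukiEtTh2009, Prop 2.4 p.38] -/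
theorem map_tp_PiXuu_eq_of_map_tp_PiCuu_of_map_tp_PiX (Γ : T.Gtp ≃ₜ* T.Gtp)
    (hCuu : (T.tp T.PiCuu).map Γ.toMulEquiv.toMonoidHom = T.tp T.PiCuu)
    (hX : (T.tp T.PiX).map Γ.toMulEquiv.toMonoidHom = T.tp T.PiX) :
    (T.tp T.PiXuu).map Γ.toMulEquiv.toMonoidHom = T.tp T.PiXuu := by
  rw [T.tp_PiXuu_eq_inf,
    Subgroup.map_inf_eq (T.tp T.PiCuu) (T.tp T.PiX) Γ.toMulEquiv.toMonoidHom (by exact Γ.injective), hCuu, hX]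

/-- **The `X̲`-clause from `C̲` and `X`** (`Π^tp_{X̲} = Π^tp_{C̲} ∩ Π^tp_X`). [cite: MochizukiEtTh2009, Prop 2.4 p.38] -/
theorem map_tp_PiXu_eq_of_map_tp_PiCu_of_map_tp_PiX (Γ : T.Gtp ≃ₜ* T.Gtp)
    (hCu : (T.tp T.PiCu).map Γ.toMulEquiv.toMonoidHom = T.tp T.PiCu)
    (hX : (T.tp T.PiX).map Γ.toMulEquiv.toMonoidHom = T.tp T.PiX) :
    (T.tp T.PiXu).map Γ.toMulEquiv.toMonoidHom = T.tp T.PiXu := by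
  rw [T.tp_PiXu_eq_inf,
    Subgroup.map_inf_eq (T.tp T.PiCu) (T.tp T.PiX) Γ.toMulEquiv.toMonoidHom (by exact Γ.injective), hCu, hX]

/-- **The `C̲`-clause from `X̲` and `C̲̲`** (`Π^tp_{C̲} = Π^tp_{X̲} ⊔ Π^tp_{C̲̲}`). [cite: MochizukiEtTh2009, Prop 2.4 p.38] -/
theorem map_tp_PiCu_eq_of_map_tp_PiXu_of_map_tp_PiCuu (Γ : T.Gtp ≃ₜ* T.Gtp)
    (hXu : (T.tp T.PiXu).map Γ.toMulEquiv.toMonoidHom = T.tp T.PiXu)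
    (hCuu : (T.tp T.PiCuu).map Γ.toMulEquiv.toMonoidHom = T.tp T.PiCuu) :
    (T.tp T.PiCu).map Γ.toMulEquiv.toMonoidHom = T.tp T.PiCu := by
  rw [T.tp_PiCu_eq_tp_PiXu_sup_tp_PiCuu, Subgroup.map_sup, hXu, hCuu]

/-- **All six stabilisations of the tower from three** (granted Def. 2.5 (i)(a)): an automorphism `Γ` of `Π^tp_C`
stabilising `Π^tp_{X̲̲}`, `Π^tp_{C̲̲}` and `Π^tp_Ÿ` stabilises every member `X̲̲, X̲, X, C̲̲, C̲, Ÿ` of the tower.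
[cite: MochizukiEtTh2009, Prop 2.4 p.38] -/
theorem forall_tower_map_eq_of_PiXuu_PiCuu_PiYddtp (hYXu : T.PiYtp ≤ T.tp T.PiXu) (Γ : T.Gtp ≃ₜ* T.Gtp)
    (hXuu : (T.tp T.PiXuu).map Γ.toMulEquiv.toMonoidHom = T.tp T.PiXuu)
    (hCuu : (T.tp T.PiCuu).map Γ.toMulEquiv.toMonoidHom = T.tp T.PiCuu)
    (hYdd : T.PiYddtp.map Γ.toMulEquiv.toMonoidHom = T.PiYddtp) :
    ∀ S ∈ T.tower, S.map Γ.toMulEquiv.toMonoidHom = S := by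
  have hX : (T.tp T.PiX).map Γ.toMulEquiv.toMonoidHom = T.tp T.PiX :=
    T.map_tp_PiX_eq_of_PiXuu Γ (by
      rw [T.index_PiXuu, show l * (l * 2) = l ^ 2 * 2 by ring]
      exact not_four_dvd_of_odd T.l_odd 2 (Or.inr rfl)) hXuu
  have hY : T.PiYtp.map Γ.toMulEquiv.toMonoidHom = T.PiYtp := T.map_PiYtp_eq_of_map_tp_PiX_of_map_PiYddtp Γ hX hYdd
  have hXu := map_tp_PiXu_eq_of_map_tp_PiX_of_map_PiYtp hYXu Γ hX hY
  have hCu := map_tp_PiCu_eq_of_map_tp_PiXu_of_map_tp_PiCuu Γ hXu hCuu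
  intro S hS
  simp only [tower, List.mem_cons, List.mem_nil_iff, or_false] at hS
  rcases hS with rfl | rfl | rfl | rfl | rfl | rfl
  exacts [hXuu, hXu, hX, hCuu, hCu, hYdd]

/-! ### Prop. 2.4 clause by clause from the core form -/

/-- **Prop. 2.4 (i) from its core form** (granted Def. 2.5 (i)(a)): if every automorphism of `Π^tp_{X̲̲}` extends to
`Π^tp_C` stabilising `Π^tp_{C̲̲}` and `Π^tp_Ÿ`, then clause (i) of `Prop24` holds (all six members).
[cite: MochizukiEtTh2009, Prop 2.4 p.38] -/
theorem prop24_i_of_core (hYXu : T.PiYtp ≤ T.tp T.PiXu)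
    (h : ∀ γ : ↥(T.tp T.PiXuu) ≃ₜ* ↥(T.tp T.PiXuu), T.ExtendsStabilising _ γ [T.tp T.PiCuu, T.PiYddtp])
    (γ : ↥(T.tp T.PiXuu) ≃ₜ* ↥(T.tp T.PiXuu)) : T.ExtendsStabilising _ γ T.tower := by
  obtain ⟨Γ, hΓ, hst⟩ := h γ
  exact ⟨Γ, hΓ, forall_tower_map_eq_of_PiXuu_PiCuu_PiYddtp hYXu Γ
    (map_eq_self_of_restricts Γ.toMulEquiv γ.toMulEquiv hΓ) (hst _ (by simp)) (hst _ (by simp))⟩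

/-- **Prop. 2.4 (ii) from its core form** (no Def. 2.5 hypothesis): if every automorphism of `Π^tp_{X̲}` extends to
`Π^tp_C` stabilising `Π^tp_Ÿ`, then clause (ii) holds (`X̲, X, Ÿ`; the `X`-clause is the index-`2` argument,
`4 ∤ 2l`). [cite: MochizukiEtTh2009, Prop 2.4 p.38] -/
theorem prop24_ii_of_core
    (h : ∀ γ : ↥(T.tp T.PiXu) ≃ₜ* ↥(T.tp T.PiXu), T.ExtendsStabilising _ γ [T.PiYddtp])
    (γ : ↥(T.tp T.PiXu) ≃ₜ* ↥(T.tp T.PiXu)) :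
    T.ExtendsStabilising _ γ [T.tp T.PiXu, T.tp T.PiX, T.PiYddtp] := by
  obtain ⟨Γ, hΓ, hst⟩ := h γ
  have hXu : (T.tp T.PiXu).map Γ.toMulEquiv.toMonoidHom = T.tp T.PiXu :=
    map_eq_self_of_restricts Γ.toMulEquiv γ.toMulEquiv hΓ
  have hX : (T.tp T.PiX).map Γ.toMulEquiv.toMonoidHom = T.tp T.PiX :=
    T.map_tp_PiX_eq_of_PiXu Γ (by
      rw [T.index_PiXu, show l * 2 = l ^ 1 * 2 by ring]
      exact not_four_dvd_of_odd T.l_odd 1 (Or.inl rfl)) hXu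
  refine ⟨Γ, hΓ, fun S hS => ?_⟩
  simp only [List.mem_cons, List.mem_nil_iff, or_false] at hS
  rcases hS with rfl | rfl | rfl
  exacts [hXu, hX, hst _ (by simp)]

/-- **Prop. 2.4 (iii) from its core form** (granted Def. 2.5 (i)(a)): if every automorphism of `Π^tp_{C̲̲}` extends
to `Π^tp_C` stabilising `Π^tp_X` and `Π^tp_Ÿ`, then clause (iii) holds (all six members).
[cite: MochizukiEtTh2009, Prop 2.4 p.38] -/
theorem prop24_iii_of_core (hYXu : T.PiYtp ≤ T.tp T.PiXu)
    (h : ∀ γ : ↥(T.tp T.PiCuu) ≃ₜ* ↥(T.tp T.PiCuu), T.ExtendsStabilising _ γ [T.tp T.PiX, T.PiYddtp])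
    (γ : ↥(T.tp T.PiCuu) ≃ₜ* ↥(T.tp T.PiCuu)) : T.ExtendsStabilising _ γ T.tower := by
  obtain ⟨Γ, hΓ, hst⟩ := h γ
  have hCuu : (T.tp T.PiCuu).map Γ.toMulEquiv.toMonoidHom = T.tp T.PiCuu :=
    map_eq_self_of_restricts Γ.toMulEquiv γ.toMulEquiv hΓ
  have hX : (T.tp T.PiX).map Γ.toMulEquiv.toMonoidHom = T.tp T.PiX := hst _ (by simp)
  exact ⟨Γ, hΓ, forall_tower_map_eq_of_PiXuu_PiCuu_PiYddtp hYXu Γ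
    (map_tp_PiXuu_eq_of_map_tp_PiCuu_of_map_tp_PiX Γ hCuu hX) hCuu (hst _ (by simp))⟩

/-- **Prop. 2.4 (iv) from its core form** (no Def. 2.5 hypothesis): if every automorphism of `Π^tp_{C̲}` extends to
`Π^tp_C` stabilising `Π^tp_X` and `Π^tp_Ÿ`, then clause (iv) holds (`C̲, X̲, X, Ÿ`; `Π^tp_{X̲} = Π^tp_{C̲} ∩ Π^tp_X`).
[cite: MochizukiEtTh2009, Prop 2.4 p.38] -/
theorem prop24_iv_of_core
    (h : ∀ γ : ↥(T.tp T.PiCu) ≃ₜ* ↥(T.tp T.PiCu), T.ExtendsStabilising _ γ [T.tp T.PiX, T.PiYddtp])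
    (γ : ↥(T.tp T.PiCu) ≃ₜ* ↥(T.tp T.PiCu)) :
    T.ExtendsStabilising _ γ [T.tp T.PiCu, T.tp T.PiXu, T.tp T.PiX, T.PiYddtp] := by
  obtain ⟨Γ, hΓ, hst⟩ := h γ
  have hCu : (T.tp T.PiCu).map Γ.toMulEquiv.toMonoidHom = T.tp T.PiCu :=
    map_eq_self_of_restricts Γ.toMulEquiv γ.toMulEquiv hΓ
  have hX : (T.tp T.PiX).map Γ.toMulEquiv.toMonoidHom = T.tp T.PiX := hst _ (by simp)
  refine ⟨Γ, hΓ, fun S hS => ?_⟩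
  simp only [List.mem_cons, List.mem_nil_iff, or_false] at hS
  rcases hS with rfl | rfl | rfl | rfl
  exacts [hCu, map_tp_PiXu_eq_of_map_tp_PiCu_of_map_tp_PiX Γ hCu hX, hX, hst _ (by simp)]

/-! ### `Prop24` ⟺ core form -/

/-- **Prop. 2.4 follows from its core form** (granted Def. 2.5 (i)(a) `Π^tp_Y ≤ Π^tp_{X̲}`): if every automorphism
of `Π^tp_{X̲̲}` (resp. `Π^tp_{X̲}`; `Π^tp_{C̲̲}`; `Π^tp_{C̲}`) extends to an automorphism of `Π^tp_C` stabilising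
`Π^tp_{C̲̲}, Π^tp_Ÿ` (resp. `Π^tp_Ÿ`; `Π^tp_X, Π^tp_Ÿ`; `Π^tp_X, Π^tp_Ÿ`), then the typed `Prop24` holds.  The hypothesis
is the absolute-anabelian content of the printed proof (the `K`-core `C`, "as in the proof of Proposition 1.8");
it is NOT proved here. [cite: MochizukiEtTh2009, Prop 2.4 p.38] -/
theorem prop24_of_core (hYXu : T.PiYtp ≤ T.tp T.PiXu)
    (h₁ : ∀ γ : ↥(T.tp T.PiXuu) ≃ₜ* ↥(T.tp T.PiXuu), T.ExtendsStabilising _ γ [T.tp T.PiCuu, T.PiYddtp])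
    (h₂ : ∀ γ : ↥(T.tp T.PiXu) ≃ₜ* ↥(T.tp T.PiXu), T.ExtendsStabilising _ γ [T.PiYddtp])
    (h₃ : ∀ γ : ↥(T.tp T.PiCuu) ≃ₜ* ↥(T.tp T.PiCuu), T.ExtendsStabilising _ γ [T.tp T.PiX, T.PiYddtp])
    (h₄ : ∀ γ : ↥(T.tp T.PiCu) ≃ₜ* ↥(T.tp T.PiCu), T.ExtendsStabilising _ γ [T.tp T.PiX, T.PiYddtp]) :
    T.Prop24 :=
  ⟨prop24_i_of_core hYXu h₁, prop24_ii_of_core h₂, prop24_iii_of_core hYXu h₃, prop24_iv_of_core h₄⟩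

/-- Conversely the typed `Prop24` contains its core form (projection onto sublists; no hypothesis).
[cite: MochizukiEtTh2009, Prop 2.4 p.38] -/
theorem core_of_prop24 (h : T.Prop24) :
    (∀ γ : ↥(T.tp T.PiXuu) ≃ₜ* ↥(T.tp T.PiXuu), T.ExtendsStabilising _ γ [T.tp T.PiCuu, T.PiYddtp]) ∧
    (∀ γ : ↥(T.tp T.PiXu) ≃ₜ* ↥(T.tp T.PiXu), T.ExtendsStabilising _ γ [T.PiYddtp]) ∧
    (∀ γ : ↥(T.tp T.PiCuu) ≃ₜ* ↥(T.tp T.PiCuu), T.ExtendsStabilising _ γ [T.tp T.PiX, T.PiYddtp]) ∧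
    (∀ γ : ↥(T.tp T.PiCu) ≃ₜ* ↥(T.tp T.PiCu), T.ExtendsStabilising _ γ [T.tp T.PiX, T.PiYddtp]) := by
  obtain ⟨hi, hii, hiii, hiv⟩ := h
  refine ⟨fun γ => ?_, fun γ => ?_, fun γ => ?_, fun γ => ?_⟩
  · obtain ⟨Γ, hΓ, hst⟩ := hi γ
    exact ⟨Γ, hΓ, fun S hS => hst S (by
      simp only [List.mem_cons, List.mem_nil_iff, or_false] at hS; rcases hS with rfl | rfl <;> simp [tower])⟩
  · obtain ⟨Γ, hΓ, hst⟩ := hii γ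
    exact ⟨Γ, hΓ, fun S hS => hst S (by
      simp only [List.mem_cons, List.mem_nil_iff, or_false] at hS; subst hS; simp)⟩
  · obtain ⟨Γ, hΓ, hst⟩ := hiii γ
    exact ⟨Γ, hΓ, fun S hS => hst S (by
      simp only [List.mem_cons, List.mem_nil_iff, or_false] at hS; rcases hS with rfl | rfl <;> simp [tower])⟩
  · obtain ⟨Γ, hΓ, hst⟩ := hiv γ
    exact ⟨Γ, hΓ, fun S hS => hst S (by
      simp only [List.mem_cons, List.mem_nil_iff, or_false] at hS; rcases hS with rfl | rfl <;> simp)⟩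

/-- **`Prop24` is EQUIVALENT over the interface to its core form**, granted Def. 2.5 (i)(a) (`Π^tp_Y ≤ Π^tp_{X̲}`):
`7` stabilisations (`Π^tp_{C̲̲}, Π^tp_Ÿ` / `Π^tp_Ÿ` / `Π^tp_X, Π^tp_Ÿ` / `Π^tp_X, Π^tp_Ÿ`) instead of the typed `19`.  What
remains to prove at a datum where Prop. 2.4 holds is exactly the right-hand side: the extension to `Π^tp_C`
(`K`-core) and the characteristic nature of `Π^tp_Ÿ`, of `Π^tp_X` (cases (iii)/(iv)) and of `Π^tp_{C̲̲}` (case (i)).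
[cite: MochizukiEtTh2009, Prop 2.4 p.38] -/
theorem prop24_iff_core (hYXu : T.PiYtp ≤ T.tp T.PiXu) :
    T.Prop24 ↔
      ((∀ γ : ↥(T.tp T.PiXuu) ≃ₜ* ↥(T.tp T.PiXuu), T.ExtendsStabilising _ γ [T.tp T.PiCuu, T.PiYddtp]) ∧
      (∀ γ : ↥(T.tp T.PiXu) ≃ₜ* ↥(T.tp T.PiXu), T.ExtendsStabilising _ γ [T.PiYddtp]) ∧
      (∀ γ : ↥(T.tp T.PiCuu) ≃ₜ* ↥(T.tp T.PiCuu), T.ExtendsStabilising _ γ [T.tp T.PiX, T.PiYddtp]) ∧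
      (∀ γ : ↥(T.tp T.PiCu) ≃ₜ* ↥(T.tp T.PiCu), T.ExtendsStabilising _ γ [T.tp T.PiX, T.PiYddtp])) :=
  ⟨core_of_prop24, fun h => prop24_of_core hYXu h.1 h.2.1 h.2.2.1 h.2.2.2⟩

end TemperedCoverData

end ThetaCovers

end Literature.AnabelianGeometry.EtaleTheta
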